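/-
Origin: expansion seat `planner-pub-hodgecm-mc-axioms-1-g14-0`, handover #W245 2026-08-20T15:53:55Z md5 144d3737680c (PKG a3ccc370ec03 → 144d3737680c; 252 l.; MECHANICAL (iib-R) rewrite v3.1 of the PKG file as it stands (15 token edits; rules R1x1+RX[h₂]x14)) (`HOME/mc/pub-hodgecm-mc-axioms-1-g14/revendor/kit-r55/stage55/HodgeCM/Model/Binders/Real34Letters.lean`, md5 144d3737680c, 252 lines);
landed by the gen-22 packager (p-g22) in gate run 55 REPLACES the earlier landed copy of `HodgeCM/Model/Binders/Real34Letters.lean` (seat copy carried the packager Origin header of an earlier run (stripped)).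
-/
/-
Origin: speedrun cell pub-hodgecm, MODEL-CONSTRUCTION sub-cell, unit pub-hodgecm-mc-binder-1-g11 (BINDER PROVER, gen 11; row 15: the census-T record
from the (34) core and ONE period identity per character, finite index and matched LETTER TUPLE), seat prover-pub-hodgecm-mc-binder-1-g11-0, 2026-08-20.
Target in PKG: HodgeCM/Model/Binders/Real34Letters.lean (NEW additive leaf; imports `Binders/Real34Eigenletters` only).  KERNEL ONLY: 2 defs
(data: the letters and their weights, by `PlaceKind` cases) + 2 theorems + 1 def-valued constructor; 0 records, nothing cited, 0 `def … : Prop`,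
MODEL-N ±0, E unchanged.  Nothing here is a claim of the manuscripts under adjudication.
-/
import Summits.HodgeConjecture.HodgeCM.Model.Binders.Real34Eigenletters

/-!
# The LETTERS of the printed local modules; row 15's residual as one period identity per matched letter tuple

`Binders/Real34Eigenletters` showed that every printed local module is spanned by torus eigenvectors.  This leaf NAMES spanning
eigenvectors — the letters — and their weights, by place kind (`FockPrintPlaces.printLoc`):

* § 1 `letterOf lam hlam vac : (k : PlaceKind) → ℕ → (printLoc lam hlam vac k).M` — `delta ↦ φ⁰ = 1`, `iota ↦ φ⁰ = det z` (the exponent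
  is ignored: the module is a line), `sigma, n ↦ P^n`; `letterWeight … : (k : PlaceKind) → ℕ → (printLoc lam hlam vac k).T → ℂ` — the printed
  character `χ` (= `vac`, resp. `vac · t₁t₂`) at `delta`, `iota`, and `vac · (t₁t₂⁻¹)^n` at `sigma`; `printLoc_ω_letterOf` (each letter is an
  eigenvector of its weight: `Real34Eigenletters.printLoc_ω_sigma_P_pow` and the `eigen` field) and `printLoc_span_letterOf` (the letters span:
  the lines by `Submodule.mem_span_singleton`, `ℂ[P] = span {P^n}` by definition);
* § 2 **`Gen12PinsP.Real34CensusSideT.ofLetters (hW) core (hletters)`** — the census-T record from binder-2's (34) core and **(W-L)**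
  `hletters`: for every character `χ`, finite index `f` and exponent tuple `n : InfinitePlace L → ℕ` whose product weight MATCHES `χ` on the
  printed torus (`∀ t, (∏_b letterWeight_b (n b) (t b)) · χ([ι_T t]) = 1`), the inserted letter tensor `insM f (⨂ₜ_b letterOf_b (n b))` is
  (34)-period-equivalent to an admissible wedge sum of the guarded S pin.  Proof: the span induction of `ofEigenlettersT`, run over pure
  tensors of LETTERS (`span_tprod_of_span_eq_top` with `printLoc_span_letterOf`); a letter tensor is a `T₃₄(ℝ)`-eigenvector with the product
  weight (`core.side.omg_ins`, `Fock.map_tprod_eq_prod_smul`, `printLoc_ω_letterOf`); matched ⇒ `hletters`, unmatched ⇒ zero period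
  (`Real34TorusZero.t34_ϑ_eq_zero_of_eigen`).

So row 15's census residual per good context reads: the (34) core TERM + one period identity per `(χ, f, n)` with `n` matched (only the
`sigma`-coordinates of `n` enter, and for fixed `χ` they are determined: distinct exponents give distinct weights `(t₁t₂⁻¹)^n`).
-/

set_option autoImplicit false

noncomputable section

open MeasureTheory NumberField MulAction
open scoped Matrix InnerProductSpace TensorProduct

attribute [-instance] Quotient.instMeasurableSpace

namespace HodgeCM.Model

open HodgeCM HodgeCM.Universe HodgeCM.Adelic HodgeCM.Model.HypCensus
open HodgeCM.PerL34 HodgeCM.PerL34.Fock HodgeCM.PerL34.Fock.PrintDict HodgeCM.PerL34.Annihilation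
open Literature.NumberTheory.Weil1964
open Literature.NumberTheory.Automorphic (piSchwartzBruhat)
open Literature.NumberTheory.GelbartRogawski1991.UnitaryDualPair
open Literature.AlgebraicGeometry.HodgeTheory
open Literature.NumberTheory.Automorphic.PicardCM
open Literature.NumberTheory.Transcendental (Arapura2012_Cor_15_4_6)
open HodgeCM.Model.ThetaSpace
open HodgeCM.Model.ArchSideTerm
open NumberField.SeesawArchTorus (toAdeles printedTorusHom printedTorusHom_apply placesEquiv)

/-! ## 1. Letters and weights of the printed local modules -/

section Letters

variable (lam : ℂ) (hlam : lam ≠ 0) (vac : Circle × Circle →* Circle)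

/-- **The letters**: `delta ↦ 1`, `iota ↦ det z` (exponent ignored), `sigma, n ↦ P^n`. -/
def letterOf : (k : PlaceKind) → ℕ → (printLoc lam hlam vac k).M
  | .sigma, n => (⟨P ^ n, P_pow_mem_kappaPartM n⟩ : ↥kappaPartM)
  | .delta, _ => (printLoc lam hlam vac .delta).φ
  | .iota, _ => (printLoc lam hlam vac .iota).φ
  | .sigmaSwap, n => (⟨P ^ n, P_pow_mem_kappaPartM n⟩ : ↥kappaPartM)

/-- **The weights of the letters**: the printed character `χ` at `delta` / `iota`, `vac · (t₁t₂⁻¹)^n` at `sigma`. -/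
def letterWeight : (k : PlaceKind) → ℕ → (printLoc lam hlam vac k).T → ℂ
  | .sigma, n => fun t : Circle × Circle => ((vac t : Circle) : ℂ) * (((t.1 : Circle) : ℂ) * (((t.2 : Circle) : ℂ))⁻¹) ^ n
  | .delta, _ => (printLoc lam hlam vac .delta).χ
  | .iota, _ => (printLoc lam hlam vac .iota).χ
  | .sigmaSwap, n => fun t : Circle × Circle => ((vac t : Circle) : ℂ) * (((t.2 : Circle) : ℂ) * (((t.1 : Circle) : ℂ))⁻¹) ^ n

/-- Each letter is a torus eigenvector of its weight. -/
theorem printLoc_ω_letterOf : ∀ (k : PlaceKind) (n : ℕ) (t : (printLoc lam hlam vac k).T),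
    (printLoc lam hlam vac k).ω t (letterOf lam hlam vac k n) = letterWeight lam hlam vac k n t • letterOf lam hlam vac k n
  | .sigma, n, t => printLoc_ω_sigma_P_pow lam hlam vac t n
  | .delta, _, t => (printLoc lam hlam vac .delta).eigen t
  | .iota, _, t => (printLoc lam hlam vac .iota).eigen t
  | .sigmaSwap, n, t => printLoc_ω_sigmaSwap_P_pow lam hlam vac t n

/-- The letters span the printed local module. -/
theorem printLoc_span_letterOf : ∀ k : PlaceKind,
    Submodule.span ℂ (Set.range (letterOf lam hlam vac k)) = ⊤
  | .sigma => by
    refine Submodule.eq_top_iff'.2 fun m => ?_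
    have key : ∀ (x : MixedModel) (hx : x ∈ Submodule.span ℂ (Set.range fun k : ℕ => P ^ k)),
        (⟨x, hx⟩ : ↥kappaPartM) ∈ Submodule.span ℂ (Set.range (letterOf lam hlam vac .sigma)) := by
      intro x hx
      induction hx using Submodule.span_induction with
      | mem y hy =>
        obtain ⟨k, rfl⟩ := hy
        exact Submodule.subset_span ⟨k, rfl⟩
      | zero => exact Submodule.zero_mem _
      | add y z hy hz ihy ihz => exact Submodule.add_mem _ ihy ihz
      | smul a y hy ih => exact Submodule.smul_mem _ a ih
    exact key m.1 m.2
  | .delta => by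
    refine Submodule.eq_top_iff'.2 fun m => ?_
    obtain ⟨a, ha⟩ := Submodule.mem_span_singleton.mp m.2
    have hm : m = a • letterOf lam hlam vac .delta 0 := Subtype.ext (by exact ha.symm)
    rw [hm]
    exact Submodule.smul_mem _ a (Submodule.subset_span ⟨0, rfl⟩)
  | .iota => by
    refine Submodule.eq_top_iff'.2 fun m => ?_
    obtain ⟨a, ha⟩ := Submodule.mem_span_singleton.mp m.2
    have hm : m = a • letterOf lam hlam vac .iota 0 := Subtype.ext (by exact ha.symm)
    rw [hm]
    exact Submodule.smul_mem _ a (Submodule.subset_span ⟨0, rfl⟩)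
  | .sigmaSwap => by
    refine Submodule.eq_top_iff'.2 fun m => ?_
    have key : ∀ (x : MixedModel) (hx : x ∈ Submodule.span ℂ (Set.range fun k : ℕ => P ^ k)),
        (⟨x, hx⟩ : ↥kappaPartM) ∈ Submodule.span ℂ (Set.range (letterOf lam hlam vac .sigmaSwap)) := by
      intro x hx
      induction hx using Submodule.span_induction with
      | mem y hy =>
        obtain ⟨k, rfl⟩ := hy
        exact Submodule.subset_span ⟨k, rfl⟩
      | zero => exact Submodule.zero_mem _
      | add y z hy hz ihy ihz => exact Submodule.add_mem _ ihy ihz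
      | smul a y hy ih => exact Submodule.smul_mem _ a ih
    exact key m.1 m.2

end Letters

/-! ## 2. The census-T record from the core and one period identity per matched letter tuple -/

namespace Gen12PinsP

variable
  (G : ∀ {L : CMField} {ι₁ : L →+* ℂ} (_V : HermSpace3 L ι₁) (_c : SeesawCtx L), Prop)
  (hG : ∀ {L : CMField} {ι₁ : L →+* ℂ} (V : HermSpace3 L ι₁) (c : SeesawCtx L),
    G V c → (∀ j, 0 < (ι₁ (dW c.D j)).re) ∨ ∀ j, (ι₁ (dW c.D j)).re < 0)
  (hGR : ∀ {L : CMField} {ι₁ : L →+* ℂ} (V : HermSpace3 L ι₁) (c : SeesawCtx L),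
    (cmSplittingDatum (L : Type) finProdFinEquiv (frameD V) (frameD_real V) (frameD_ne V) (dW c.D) (dW_real c.D)
      (dW_ne c.D)).CompatibleSplitting)
  (η : ∀ {L : CMField} {ι₁ : L →+* ℂ} (V : HermSpace3 L ι₁) (c : SeesawCtx L),
    CMAdelic (L : Type) (frameD V) × CMAdelic (L : Type) (dW c.D) →* ℂˣ)
  (hη : ∀ {L : CMField} {ι₁ : L →+* ℂ} (V : HermSpace3 L ι₁) (c : SeesawCtx L),
    ∀ γU ∈ CMRat (L : Type) (frameD V), ∀ γ ∈ CMRat (L : Type) (dW c.D), η V c (γU, γ) = 1)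
  (hηc : ∀ {L : CMField} {ι₁ : L →+* ℂ} (V : HermSpace3 L ι₁) (c : SeesawCtx L), Continuous fun p => ((η V c p : ℂˣ) : ℂ))
  (hGR₀ : ∀ {L : CMField} {ι₁ : L →+* ℂ} (V : HermSpace3 L ι₁) (c : SeesawCtx L),
    (cmSplittingDatum (L : Type) (e₁) (frameD V) (frameD_real V) (frameD_ne V) (lineVec (L : Type) (dW c.D 0))
      (fun _ => dW_real c.D 0) (fun _ => dW_ne c.D 0)).CompatibleSplitting)
  (hGR₁ : ∀ {L : CMField} {ι₁ : L →+* ℂ} (V : HermSpace3 L ι₁) (c : SeesawCtx L),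
    (cmSplittingDatum (L : Type) (e₁) (frameD V) (frameD_real V) (frameD_ne V) (lineVec (L : Type) (dW c.D 1))
      (fun _ => dW_real c.D 1) (fun _ => dW_ne c.D 1)).CompatibleSplitting)
  (hGR₂ : ∀ {L : CMField} {ι₁ : L →+* ℂ} (V : HermSpace3 L ι₁) (c : SeesawCtx L),
    (cmSplittingDatum (L : Type) (e₁) (frameD V) (frameD_real V) (frameD_ne V) (lineVec (L : Type) (dW' c.D 0))
      (fun _ => dW'_real c.D 0) (fun _ => dW'_ne c.D 0)).CompatibleSplitting)
  (hGR₃ : ∀ {L : CMField} {ι₁ : L →+* ℂ} (V : HermSpace3 L ι₁) (c : SeesawCtx L),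
    (cmSplittingDatum (L : Type) (e₁) (frameD V) (frameD_real V) (frameD_ne V) (lineVec (L : Type) (dW' c.D 1))
      (fun _ => dW'_real c.D 1) (fun _ => dW'_ne c.D 1)).CompatibleSplitting)
  (AG : ∀ {L : CMField} {ι₁ : L →+* ℂ} (V : HermSpace3 L ι₁) (c : SeesawCtx L), G V c → ∀ k : Fin 4,
    ArchLineInput V (lineRepD V c.D (hGR V c) (hGR₀ V c) (hGR₁ V c) (hGR₂ V c) (hGR₃ V c) (η V c) k))

variable (hHD : exists_isReal_hodgeModel) (hI : hodgePQ_independent_of_hodgeModel)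
  (h₁ : BallQuotientUniformised)  (h₃ : CMAbelianVarietyRealised)
  (h : Bool) (hA : Arapura2012_Cor_15_4_6) (μ : ∀ {L : CMField}, SeesawCtx L → Fin 4 → InfinitePlace L → ℤ)

section Context34

variable {L : CMField} {ι₁ : L →+* ℂ} (V : HermSpace3 L ι₁) (c : SeesawCtx L) (hV : IsAnisotropic L V.Hm)

/-- **`Real34CensusSideT` from the (34) census core and ONE period identity per matched letter tuple** ((W-L) `hletters`; see the
module doc).  Span induction over pure tensors of letters; unmatched letter tensors have zero (34) period. -/
def Real34CensusSideT.ofLetters (hW : IsAnisotropic L c.D.gramW)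
    (core : HypCoreW ((Gen12Pins.Wg @hGR @η @hη @hηc @Gen12Pins.τSyl @Gen12Pins.TSyl @Gen12Pins.hTSyl) V c) c.D.jT₃₄ (fun w => -μ c 2 w) (fun w => -μ c 3 w))
    (hletters : letI := core.decEq
      ∀ (χ : ((pinT hHD hI h₁ h₃ h hA (Gen12Pins.Wg @hGR @η @hη @hηc @Gen12Pins.τSyl @Gen12Pins.TSyl @Gen12Pins.hTSyl) (SInstance.SGP @G @hG @hGR @η @hη @hηc @hGR₀ @hGR₁ @hGR₂ @hGR₃ @AG) μ).t34 V c).X) (f : core.side.FinIdx) (n : InfinitePlace (L : Type) → ℕ),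
        (∀ t : (printPlaces (InfinitePlace (L : Type)) core.kind core.lam core.hlam (pinnedVacs core.kind (fun w => -μ c 2 w) (fun w => -μ c 3 w))).Tg, (∏ b, letterWeight (core.lam b) (core.hlam b) ((pinnedVacs core.kind (fun w => -μ c 2 w) (fun w => -μ c 3 w)) b) (core.kind b) (n b) (t b)) * dualChar χ.1 (QuotientGroup.mk (toAdeles (L : Type) ((placesEquiv (L : Type)).symm (placesCoord (InfinitePlace (L : Type)) core.kind core.lam core.hlam (pinnedVacs core.kind (fun w => -μ c 2 w) (fun w => -μ c 3 w)) t)))) = 1) →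
        ∃ Ψ : ↥((wmOf' printFact_unitaryCompact_holds ((Gen12Pins.Wg @hGR @η @hη @hηc @Gen12Pins.τSyl @Gen12Pins.TSyl @Gen12Pins.hTSyl) V c)).SK),
          (Subtype.val Ψ : piSchwartzBruhat (↥(maximalRealSubfield L)) (Fin 6)) ∈
              admWedgeSpan hHD hI h₁ h₃ ((SInstance.SGP @G @hG @hGR @η @hη @hηc @hGR₀ @hGR₁ @hGR₂ @hGR₃ @AG) V c) hV ∧
            ((pinT hHD hI h₁ h₃ h hA (Gen12Pins.Wg @hGR @η @hη @hηc @Gen12Pins.τSyl @Gen12Pins.TSyl @Gen12Pins.hTSyl) (SInstance.SGP @G @hG @hGR @η @hη @hηc @hGR₀ @hGR₁ @hGR₂ @hGR₃ @AG) μ).t34 V c).ϑ χ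
                (insM printFact_unitaryCompact_holds ((Gen12Pins.Wg @hGR @η @hη @hηc @Gen12Pins.τSyl @Gen12Pins.TSyl @Gen12Pins.hTSyl) V c) c.D.jT₃₄ core.kind core.lam core.hlam
                  (fun w => -μ c 2 w) (fun w => -μ c 3 w) core.side f
                  (PiTensorProduct.tprod ℂ fun b => letterOf (core.lam b) (core.hlam b) ((pinnedVacs core.kind (fun w => -μ c 2 w) (fun w => -μ c 3 w)) b) (core.kind b) (n b))) =
              ((pinT hHD hI h₁ h₃ h hA (Gen12Pins.Wg @hGR @η @hη @hηc @Gen12Pins.τSyl @Gen12Pins.TSyl @Gen12Pins.hTSyl) (SInstance.SGP @G @hG @hGR @η @hη @hηc @hGR₀ @hGR₁ @hGR₂ @hGR₃ @AG) μ).t34 V c).ϑ χ Ψ) :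
    Real34CensusSideT @G @hG @hGR @η @hη @hηc @hGR₀ @hGR₁ @hGR₂ @hGR₃ @AG hHD hI h₁ h₃ h hA @μ V c hV := by
  letI := core.decEq
  refine ⟨core, fun χ f φ => ?_⟩
  -- (i) the eigen-relation for printed pure tensors of eigenletters
  have heig : ∀ (m : ∀ b : InfinitePlace (L : Type), ((printPlaces (InfinitePlace (L : Type)) core.kind core.lam core.hlam (pinnedVacs core.kind (fun w => -μ c 2 w) (fun w => -μ c 3 w))).loc b).M) (cχ : ∀ b : InfinitePlace (L : Type), ((printPlaces (InfinitePlace (L : Type)) core.kind core.lam core.hlam (pinnedVacs core.kind (fun w => -μ c 2 w) (fun w => -μ c 3 w))).loc b).T → ℂ),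
      (∀ b t, ((printPlaces (InfinitePlace (L : Type)) core.kind core.lam core.hlam (pinnedVacs core.kind (fun w => -μ c 2 w) (fun w => -μ c 3 w))).loc b).ω t (m b) = cχ b t • m b) → ∀ t : (printPlaces (InfinitePlace (L : Type)) core.kind core.lam core.hlam (pinnedVacs core.kind (fun w => -μ c 2 w) (fun w => -μ c 3 w))).Tg,
      ((((Gen12Pins.Wg @hGR @η @hη @hηc @Gen12Pins.τSyl @Gen12Pins.TSyl @Gen12Pins.hTSyl) V c).ρ (1, ((Gen12Pins.Wg @hGR @η @hη @hηc @Gen12Pins.τSyl @Gen12Pins.TSyl @Gen12Pins.hTSyl) V c).eW ((c.D.jT₃₄.toMonoidHom.comp (toAdeles (L : Type))) ((placesEquiv (L : Type)).symm (placesCoord (InfinitePlace (L : Type)) core.kind core.lam core.hlam (pinnedVacs core.kind (fun w => -μ c 2 w) (fun w => -μ c 3 w)) t)))) : Module.End ℂ (piSchwartzBruhat ((Gen12Pins.Wg @hGR @η @hη @hηc @Gen12Pins.τSyl @Gen12Pins.TSyl @Gen12Pins.hTSyl) V c).F ((Gen12Pins.Wg @hGR @η @hη @hηc @Gen12Pins.τSyl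 @Gen12Pins.TSyl @Gen12Pins.hTSyl) V c).ι))
          (core.side.ins f (PiTensorProduct.tprod ℂ m))) =
        (∏ b, cχ b (t b)) • core.side.ins f (PiTensorProduct.tprod ℂ m) := by
    intro m cχ hm t
    have homg := core.side.omg_ins f t (PiTensorProduct.tprod ℂ m)
    rw [printedTorusHom_apply] at homg
    change (((Gen12Pins.Wg @hGR @η @hη @hηc @Gen12Pins.τSyl @Gen12Pins.TSyl @Gen12Pins.hTSyl) V c).ρ (1, _) : Module.End ℂ (piSchwartzBruhat ((Gen12Pins.Wg @hGR @η @hη @hηc @Gen12Pins.τSyl @Gen12Pins.TSyl @Gen12Pins.hTSyl) V c).F ((Gen12Pins.Wg @hGR @η @hη @hηc @Gen12Pins.τSyl @Gen12Pins.TSyl @Gen12Pins.hTSyl) V c).ι)) _ = _ at homg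
    rw [homg]
    have hω : (printPlaces (InfinitePlace (L : Type)) core.kind core.lam core.hlam (pinnedVacs core.kind (fun w => -μ c 2 w) (fun w => -μ c 3 w))).ωT t (PiTensorProduct.tprod ℂ m) = (∏ b, cχ b (t b)) • PiTensorProduct.tprod ℂ m :=
      map_tprod_eq_prod_smul (fun b => ((printPlaces (InfinitePlace (L : Type)) core.kind core.lam core.hlam (pinnedVacs core.kind (fun w => -μ c 2 w) (fun w => -μ c 3 w))).loc b).ω) cχ m hm t
    rw [hω]
    exact (core.side.ins f).map_smul _ _
  -- (ii) the `hwedgeT` property along the span of the letter pure tensors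
  have key : ∀ ψ : (printPlaces (InfinitePlace (L : Type)) core.kind core.lam core.hlam (pinnedVacs core.kind (fun w => -μ c 2 w) (fun w => -μ c 3 w))).F,
      ψ ∈ Submodule.span ℂ {x : (printPlaces (InfinitePlace (L : Type)) core.kind core.lam core.hlam (pinnedVacs core.kind (fun w => -μ c 2 w) (fun w => -μ c 3 w))).F | ∃ m : ∀ b, ((printPlaces (InfinitePlace (L : Type)) core.kind core.lam core.hlam (pinnedVacs core.kind (fun w => -μ c 2 w) (fun w => -μ c 3 w))).loc b).M,
        (∀ b, m b ∈ Set.range (letterOf (core.lam b) (core.hlam b) ((pinnedVacs core.kind (fun w => -μ c 2 w) (fun w => -μ c 3 w)) b) (core.kind b))) ∧ x = PiTensorProduct.tprod ℂ m} →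
      ∃ Ψ : ↥((wmOf' printFact_unitaryCompact_holds ((Gen12Pins.Wg @hGR @η @hη @hηc @Gen12Pins.τSyl @Gen12Pins.TSyl @Gen12Pins.hTSyl) V c)).SK),
        (Subtype.val Ψ : piSchwartzBruhat (↥(maximalRealSubfield L)) (Fin 6)) ∈ admWedgeSpan hHD hI h₁ h₃ ((SInstance.SGP @G @hG @hGR @η @hη @hηc @hGR₀ @hGR₁ @hGR₂ @hGR₃ @AG) V c) hV ∧
          ((pinT hHD hI h₁ h₃ h hA (Gen12Pins.Wg @hGR @η @hη @hηc @Gen12Pins.τSyl @Gen12Pins.TSyl @Gen12Pins.hTSyl) (SInstance.SGP @G @hG @hGR @η @hη @hηc @hGR₀ @hGR₁ @hGR₂ @hGR₃ @AG) μ).t34 V c).ϑ χ (insM printFact_unitaryCompact_holds ((Gen12Pins.Wg @hGR @η @hη @hηc @Gen12Pins.τSyl @Gen12Pins.TSyl @Gen12Pins.hTSyl) V c) c.D.jT₃₄ core.kind core.lam core.hlam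
              (fun w => -μ c 2 w) (fun w => -μ c 3 w) core.side f ψ) = ((pinT hHD hI h₁ h₃ h hA (Gen12Pins.Wg @hGR @η @hη @hηc @Gen12Pins.τSyl @Gen12Pins.TSyl @Gen12Pins.hTSyl) (SInstance.SGP @G @hG @hGR @η @hη @hηc @hGR₀ @hGR₁ @hGR₂ @hGR₃ @AG) μ).t34 V c).ϑ χ Ψ := by
    intro ψ hψ
    induction hψ using Submodule.span_induction with
    | mem x hx =>
      obtain ⟨m, hm, rfl⟩ := hx
      choose n hn using hm
      have hmn : (fun b => letterOf (core.lam b) (core.hlam b) ((pinnedVacs core.kind (fun w => -μ c 2 w) (fun w => -μ c 3 w)) b) (core.kind b) (n b)) = m := funext fun b => hn b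
      subst hmn
      have hcχ : ∀ b t, ((printPlaces (InfinitePlace (L : Type)) core.kind core.lam core.hlam (pinnedVacs core.kind (fun w => -μ c 2 w) (fun w => -μ c 3 w))).loc b).ω t (letterOf (core.lam b) (core.hlam b) ((pinnedVacs core.kind (fun w => -μ c 2 w) (fun w => -μ c 3 w)) b) (core.kind b) (n b)) = letterWeight (core.lam b) (core.hlam b) ((pinnedVacs core.kind (fun w => -μ c 2 w) (fun w => -μ c 3 w)) b) (core.kind b) (n b) t • letterOf (core.lam b) (core.hlam b) ((pinnedVacs core.kind (fun w => -μ c 2 w) (fun w => -μ c 3 w)) b) (core.kind b) (n b) :=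
        fun b t => printLoc_ω_letterOf (core.lam b) (core.hlam b) ((pinnedVacs core.kind (fun w => -μ c 2 w) (fun w => -μ c 3 w)) b) (core.kind b) (n b) t
      by_cases hmt : ∀ t : (printPlaces (InfinitePlace (L : Type)) core.kind core.lam core.hlam (pinnedVacs core.kind (fun w => -μ c 2 w) (fun w => -μ c 3 w))).Tg, (∏ b, letterWeight (core.lam b) (core.hlam b) ((pinnedVacs core.kind (fun w => -μ c 2 w) (fun w => -μ c 3 w)) b) (core.kind b) (n b) (t b)) * dualChar χ.1 (QuotientGroup.mk (toAdeles (L : Type) ((placesEquiv (L : Type)).symm (placesCoord (InfinitePlace (L : Type)) core.kind core.lam core.hlam (pinnedVacs core.kind (fun w => -μ c 2 w) (fun w => -μ c 3 w)) t)))) = 1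
      · -- matched: the witness of `hletters`
        exact hletters χ f n hmt
      · -- unmatched: zero period
        simp only [not_forall] at hmt
        obtain ⟨t, ht⟩ := hmt
        refine ⟨0, by rw [WeilThetaModel.coe_zero]; exact Submodule.zero_mem _, ?_⟩
        rw [t34_ϑ_zero hHD hI h₁ h₃ h hA (Gen12Pins.Wg @hGR @η @hη @hηc @Gen12Pins.τSyl @Gen12Pins.TSyl @Gen12Pins.hTSyl) (SInstance.SGP @G @hG @hGR @η @hη @hηc @hGR₀ @hGR₁ @hGR₂ @hGR₃ @AG) μ V c hW χ]
        exact t34_ϑ_eq_zero_of_eigen hHD hI h₁ h₃ h hA (Gen12Pins.Wg @hGR @η @hη @hηc @Gen12Pins.τSyl @Gen12Pins.TSyl @Gen12Pins.hTSyl) (SInstance.SGP @G @hG @hGR @η @hη @hηc @hGR₀ @hGR₁ @hGR₂ @hGR₃ @AG) μ V c hW χ _ _ (∏ b, letterWeight (core.lam b) (core.hlam b) ((pinnedVacs core.kind (fun w => -μ c 2 w) (fun w => -μ c 3 w)) b) (core.kind b) (n b) (t b))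
          (by rw [val_insM]; exact heig _ (fun b => letterWeight (core.lam b) (core.hlam b) ((pinnedVacs core.kind (fun w => -μ c 2 w) (fun w => -μ c 3 w)) b) (core.kind b) (n b)) hcχ t) ht
    | zero => exact ⟨0, by rw [WeilThetaModel.coe_zero]; exact Submodule.zero_mem _, by rw [map_zero]⟩
    | add x y _ _ hx hy =>
      obtain ⟨Ψ₁, hΨ₁, h₁'⟩ := hx
      obtain ⟨Ψ₂, hΨ₂, h₂'⟩ := hy
      refine ⟨Ψ₁ + Ψ₂, by rw [WeilThetaModel.coe_add]; exact Submodule.add_mem _ hΨ₁ hΨ₂, ?_⟩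
      rw [map_add, t34_ϑ_add hHD hI h₁ h₃ h hA (Gen12Pins.Wg @hGR @η @hη @hηc @Gen12Pins.τSyl @Gen12Pins.TSyl @Gen12Pins.hTSyl) (SInstance.SGP @G @hG @hGR @η @hη @hηc @hGR₀ @hGR₁ @hGR₂ @hGR₃ @AG) μ V c hW χ, t34_ϑ_add hHD hI h₁ h₃ h hA (Gen12Pins.Wg @hGR @η @hη @hηc @Gen12Pins.τSyl @Gen12Pins.TSyl @Gen12Pins.hTSyl) (SInstance.SGP @G @hG @hGR @η @hη @hηc @hGR₀ @hGR₁ @hGR₂ @hGR₃ @AG) μ V c hW χ, h₁', h₂']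
    | smul a x _ hx =>
      obtain ⟨Ψ, hΨ, h'⟩ := hx
      refine ⟨a • Ψ, by rw [WeilThetaModel.coe_smul]; exact Submodule.smul_mem _ a hΨ, ?_⟩
      rw [map_smul, t34_ϑ_smul hHD hI h₁ h₃ h hA (Gen12Pins.Wg @hGR @η @hη @hηc @Gen12Pins.τSyl @Gen12Pins.TSyl @Gen12Pins.hTSyl) (SInstance.SGP @G @hG @hGR @η @hη @hηc @hGR₀ @hGR₁ @hGR₂ @hGR₃ @AG) μ V c hW χ, t34_ϑ_smul hHD hI h₁ h₃ h hA (Gen12Pins.Wg @hGR @η @hη @hηc @Gen12Pins.τSyl @Gen12Pins.TSyl @Gen12Pins.hTSyl) (SInstance.SGP @G @hG @hGR @η @hη @hηc @hGR₀ @hGR₁ @hGR₂ @hGR₃ @AG) μ V c hW χ, h']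
  -- (iii) letter pure tensors span the printed module
  exact key φ (Submodule.eq_top_iff'.mp (span_tprod_of_span_eq_top
    (fun b => Set.range (letterOf (core.lam b) (core.hlam b) ((pinnedVacs core.kind (fun w => -μ c 2 w) (fun w => -μ c 3 w)) b) (core.kind b)))
    (fun b => printLoc_span_letterOf (core.lam b) (core.hlam b) ((pinnedVacs core.kind (fun w => -μ c 2 w) (fun w => -μ c 3 w)) b) (core.kind b))) φ)

end Context34

end Gen12PinsP

end HodgeCM.Model

end
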